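import Summits.HubbardSuperconductivity.HubbardSuperconductivity.Theorems.AnisotropyChordStiffnessDiamagnetic
import Summits.HubbardSuperconductivity.HubbardSuperconductivity.Theorems.AnisotropyChordStiffnessHandoffs

/-!
# Route `AnisotropyChord` / H0 rotor rung: the diamagnetic grid bound — the CORRECTED typed hand-off
# `DiamagneticGridBound3` (side condition `3 ≤ L`) and its discharge; the typed `DiamagneticGridBound`
# (theory seat Sketch8 Part I, all `L`) is false at `L ∈ {1, 2}` and is NOT claimed.

* `DiamagneticGridBound3 Δ M` — `DiamagneticGridBound` with `3 ≤ L` (the only change);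
* **`diamagneticGridBound3_holds : ∀ Δ M, DiamagneticGridBound3 Δ M`** (`diamagneticGridBound_of_three_le`);
The consumer (S5) works eventually in `L`, so the side condition costs nothing downstream.
-/

set_option linter.dupNamespace false

noncomputable section

open Matrix Complex Finset
open scoped ComplexConjugate
open Literature.MathematicalPhysics.QuantumLattice hiding torusPhase torusNorm
open Literature.Probability.LatticeModels
open Summit.HubbardSuperconductivity.HubbardSuperconductivity.Theorems.AnisotropyChord.InsertionEntropy
  (IsPerronSectorGroundAmplitude)

namespace Summit.HubbardSuperconductivity.HubbardSuperconductivity.Theorems.AnisotropyChord.Stiffness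

/-- **(S5)(c) CORRECTED — `DiamagneticGridBound3`**: the diamagnetic grid bound `K^{tot}(k′) ≼ diag(tᵢ/2)` in
variational form, for every lattice size `L ≥ 3` (at `L = 2` the directed bonds `(x, x+eᵢ)` double-cover the
edges of the 4-cycle and the inequality fails by a factor up to `2`; at `L = 1` the «bond current» `j_{xx} = Sᶻ_x`
is spurious): for every Perron sector state `ψ = toC aM`, every grid momentum `k′`, every `η ∈ ℂ²` and every `φ`
in the sector, `2 |⟨φ, J_{η,k′} ψ⟩|² ≤ (Σᵢ |ηᵢ|² ⟨−Tᵢ⟩) · ⟨φ, (H − E₀) φ⟩`.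
[conjecture: theory seat hubbard-h0-rotor-theory-1, cycle 8, 2026-08-28 — memo ROTOR-THEORY-8 §109 (S5)(c), side condition 3 ≤ L added by the prover seat; PROVED below] -/
def DiamagneticGridBound3 (Δ : ℝ) (M : ℕ → ℝ) : Prop :=
  ∀ (L : ℕ) [NeZero L], 3 ≤ L → ∀ (aM : TensorIndex (TorusSite 2 L) 2 → ℝ),
    IsPerronSectorGroundAmplitude L Δ (M L - 1) aM →
      ∀ (k : TorusSite 2 L) (η : Fin 2 → ℂ) (φ : TensorIndex (TorusSite 2 L) 2 → ℂ),
        φ ∈ spinZSector (Λ := TorusSite 2 L) 1 (M L - 1) →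
          2 * ‖star φ ⬝ᵥ ((∑ i : Fin 2, η i • currentMode L k i) *ᵥ toC L aM)‖ ^ 2
            ≤ (∑ i : Fin 2, ‖η i‖ ^ 2 * (star (toC L aM) ⬝ᵥ (kineticOp L i *ᵥ toC L aM)).re)
              * (star φ ⬝ᵥ ((hcbHamiltonian L Δ
                    - ((lowestEnergyInSector 1 (hcbHamiltonian L Δ) (M L - 1) : ℝ) : ℂ)
                        • (1 : Op (TorusSite 2 L) 2)) *ᵥ φ)).re

/-- **`DiamagneticGridBound3` HOLDS** for every anisotropy and every sector sequence (stub (S5)(c) of THEOREM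
TWIST-IR is a tree theorem, `diamagneticGridBound_of_three_le`). [folklore] -/
theorem diamagneticGridBound3_holds (Δ : ℝ) (M : ℕ → ℝ) : DiamagneticGridBound3 Δ M :=
  fun L _ hL aM ha k η φ hφ => diamagneticGridBound_of_three_le hL Δ (M L - 1) aM ha k η φ hφ

end Summit.HubbardSuperconductivity.HubbardSuperconductivity.Theorems.AnisotropyChord.Stiffness
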